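import Literature.Geometry.Lorentzian.CarterFluxKernelBound
import Literature.Geometry.Lorentzian.CarterConeArithmetic
import Literature.Geometry.Lorentzian.CarterFluxBookkeeping
import HarnessLib

/-!
# The flux-regime cone kernel bound in the tortoise variable, Λ-polynomial constants
# (stub `stub_fluxRegimeCorePoly` of the line `olver-dunster-uniform-reduction`)

Crux `PhaseMixingCapture.KappaExplicitWaveDecay` (stmt-FinalStateConjecture-10654), line
`olver-dunster-uniform-reduction`, stub `stub_fluxRegimeCorePoly` (skeleton v7.1): the two-point bound

  `‖u_𝓗(x)‖ · ‖u_𝓘(x′)‖ ≤ C(M, δ) · Λ^N · κ^{−N} · ‖u_𝓗 u_𝓘′ − u_𝓘 u_𝓗′‖`,  `x ≤ x′`,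

for the horizon- and infinity-normalised solutions of Carter's radial equation
`u″ + (ω² − V(ρ x)) u = 0` (`V = Kerr.sepPotential M a ω m Λ`, `ρ` a tortoise radius, DRSR
arXiv:1402.7034 §5.2.3) of a sub-extremal Kerr exterior `a₁ ≤ |a| < M`, at the frequencies of the
near-extremal threshold cone `|ω − mω₊| ≤ ε₀ m` (`0 < m`) that lie in the FLUX REGIME
`δκ ≤ |ω − mω₊|`, `ω(ω − mω₊) ≥ 0` (`κ = Kerr.surfaceGravity`), GIVEN the census of the full potential
(no well in the cone: `{r > r₊ : ω² ≤ V r}` order-connected) as a hypothesis.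

The analytic content is `Kerr.fluxRegime_kernel_le` (`Literature/Geometry/Lorentzian/CarterFluxKernelBound.lean`: single barrier,
one-sided envelopes, two-point kernel bound with the explicit constant `K`); this file is the bookkeeping
`Kerr.coneMaster_bounds` + `Kerr.kernelConstant_le_pow` (+ `farRadius_le_pow`, `logArg_le_pow`,
`exp_le_logArg_pow`): in the cone with `M/2 ≤ |a|`, `ε₀ ≤ 1/(16M)`, every atom of `K` is a power of the
master variable `Y = 8(1 + M + M⁻¹)⁴(1 + δ⁻¹)·Λ/κ`, whence `C(M, δ)Λ^Nκ^{-N}` with `N = 176`,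
`C = c_K·(8(1 + M + M⁻¹)⁴(1 + δ⁻¹))^N`.
-/

set_option linter.dupNamespace false

noncomputable section

namespace Summit.FinalStateConjecture.FinalStateConjecture.Theorems.KappaExplicitWaveDecay.OlverDunsterUniformReduction

open Literature.Geometry.Lorentzian Literature.Analysis.ODE
open MeasureTheory Filter Set Complex
open scoped Topology ComplexConjugate

/-! ### Scalar bookkeeping for the registered stub -/

/-- The auxiliary exponent `η = min(δ,1)κ/2`: `0 < η`, `η ≤ κ/2`, `η² ≤ σ²/4` (from `δκ ≤ |σ|`) and
`η² ≤ 6/M²` (from `κ ≤ 1/(4M)`). [folklore] -/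
theorem eta_bounds {δ κ σ M : ℝ} (hδ : 0 < δ) (hκ : 0 < κ) (hM : 0 < M) (hκle : κ ≤ 1 / (4 * M))
    (hflux : δ * κ ≤ |σ|) :
    0 < min δ 1 * κ / 2 ∧ min δ 1 * κ / 2 ≤ κ / 2 ∧ (min δ 1 * κ / 2) ^ 2 ≤ σ ^ 2 / 4 ∧
      (min δ 1 * κ / 2) ^ 2 ≤ 6 / M ^ 2 := by
  have hmin0 : 0 < min δ 1 := lt_min hδ one_pos
  have hη0 : 0 < min δ 1 * κ / 2 := by positivity
  have hηκ : min δ 1 * κ / 2 ≤ κ / 2 := by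
    have : min δ 1 * κ ≤ 1 * κ := mul_le_mul_of_nonneg_right (min_le_right _ _) hκ.le
    linarith
  refine ⟨hη0, hηκ, ?_, ?_⟩
  · have h1 : min δ 1 * κ / 2 ≤ |σ| / 2 := by
      have : min δ 1 * κ ≤ δ * κ := mul_le_mul_of_nonneg_right (min_le_left _ _) hκ.le
      linarith
    have h2 := mul_le_mul h1 h1 hη0.le (by positivity)
    have h3 : |σ| / 2 * (|σ| / 2) = σ ^ 2 / 4 := by rw [← sq_abs σ]; ring
    rw [h3, ← sq] at h2
    exact h2
  · have h1 : min δ 1 * κ / 2 ≤ 1 / (8 * M) := by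
      calc min δ 1 * κ / 2 ≤ κ / 2 := hηκ
        _ ≤ 1 / (4 * M) / 2 := by linarith
        _ = 1 / (8 * M) := by ring
    have h2 : (min δ 1 * κ / 2) ^ 2 ≤ (1 / (8 * M)) ^ 2 := pow_le_pow_left₀ hη0.le h1 2
    have h3 : (1 / (8 * M)) ^ 2 ≤ 6 / M ^ 2 := by
      have e1 : (1 / (8 * M)) ^ 2 = 1 / (8 * M) ^ 2 := by rw [div_pow, one_pow]
      have e2 : (6 : ℝ) / M ^ 2 = 384 / (8 * M) ^ 2 := by
        field_simp; ring
      rw [e1, e2]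
      exact div_le_div_of_nonneg_right (by norm_num) (by positivity)
    exact h2.trans h3

/-- In the cone `|σ| ≤ m/(16M)` with `m² ≤ Λ`: `σ²M² ≤ Λ` (indeed `≤ Λ/256`). [folklore] -/
theorem sigma_sq_mul_sq_le {σ M Λ : ℝ} {m : ℤ} (hM : 0 < M) (hσm : |σ| ≤ m / (16 * M))
    (hmΛ : (m : ℝ) ^ 2 ≤ Λ) : σ ^ 2 * M ^ 2 ≤ Λ := by
  have h0 : 0 ≤ (m : ℝ) / (16 * M) := (abs_nonneg σ).trans hσm
  have h2 : |σ| * (16 * M) ≤ m := by rwa [← le_div_iff₀ (by positivity)]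
  have h1 : (|σ| * (16 * M)) ^ 2 ≤ (m : ℝ) ^ 2 := pow_le_pow_left₀ (by positivity) h2 2
  have e : (|σ| * (16 * M)) ^ 2 = 256 * (σ ^ 2 * M ^ 2) := by rw [mul_pow, sq_abs]; ring
  rw [e] at h1
  nlinarith [sq_nonneg σ, sq_nonneg M, mul_nonneg (sq_nonneg σ) (sq_nonneg M)]

/-! ### The registered stub -/

/-- **`stub_fluxRegimeCorePoly`** (skeleton v7.1 of the line `olver-dunster-uniform-reduction`, crux
`PhaseMixingCapture.KappaExplicitWaveDecay`). GIVEN the census of the full Carter potential in the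
near-extremal threshold cone (no well: `{r > r₊ : ω² ≤ V r}` order-connected), for every `δ > 0`, `M > 0`,
`θ > 0` there are `a₁ < M`, `ε₀ > 0`, `C > 0`, `N` such that for `a₁ ≤ |a| < M`, admissible `(ω, m, Λ)`
with `0 < m` in the cone `|ω − mω₊| ≤ ε₀ m`, in the flux regime `δκ ≤ |ω − mω₊|`, `ω(ω − mω₊) ≥ 0`,
every tortoise radius `ρ`, every pair `u_𝓗, u_𝓘` of solutions of `u″ + (ω² − V(ρ x))u = 0` with the
horizon data (`‖u_𝓗‖ → 1`, `‖u_𝓗′‖ → |ω − mω₊|`, flux `−(ω − mω₊)`) and infinity data (`‖u_𝓘‖ → 1`,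
`‖u_𝓘′‖ → |ω|`, flux `ω`), and all `x ≤ x′` (with `ρ x′` beyond the collar, unused):
`‖u_𝓗(x)‖‖u_𝓘(x′)‖ ≤ C Λ^N κ^{-N} ‖u_𝓗 u_𝓘′ − u_𝓘 u_𝓗′‖(x)`. Proof: `a₁ = max(a₁⁰, M/2)`,
`ε₀ = min(ε₀⁰, 1/(16M))` (census constants `a₁⁰, ε₀⁰`), `η = min(δ,1)κ/2`, `Kerr.fluxRegime_kernel_le`, and the
bookkeeping `Kerr.coneMaster_bounds` + `Kerr.kernelConstant_le_pow` with `Y = A₀Λ/κ`,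
`A₀ = 8(1 + M + M⁻¹)⁴(1 + δ⁻¹)`, `C = c_K A₀^N`. -/
theorem stub_fluxRegimeCorePoly :
    (∀ M : ℝ, 0 < M → ∃ a₁ ε₀ : ℝ, a₁ < M ∧ 0 < ε₀ ∧
      ∀ a : ℝ, a₁ ≤ |a| → Kerr.IsSubextremal M a →
        ∀ (ω : ℝ) (m : ℤ) (Λ : ℝ), Kerr.IsAdmissibleTriple a ω m Λ → m ≠ 0 →
          |ω - m * Kerr.horizonAngularVelocity M a| ≤ ε₀ * |(m : ℝ)| →
            (Ioi (Kerr.rPlus M a) ∩ {r : ℝ | ω ^ 2 ≤ Kerr.sepPotential M a ω m Λ r}).OrdConnected) →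
    ∀ δ : ℝ, 0 < δ →
    (∀ M : ℝ, 0 < M → ∀ θ : ℝ, 0 < θ → ∃ (a₁ ε₀ C : ℝ) (N : ℕ), a₁ < M ∧ 0 < ε₀ ∧ 0 < C ∧
      ∀ a : ℝ, a₁ ≤ |a| → Kerr.IsSubextremal M a →
        ∀ (ω : ℝ) (m : ℤ) (Λ : ℝ), Kerr.IsAdmissibleTriple a ω m Λ → 0 < m →
          |ω - m * Kerr.horizonAngularVelocity M a| ≤ ε₀ * |(m : ℝ)| → (δ * Kerr.surfaceGravity M a ≤ |ω - m * Kerr.horizonAngularVelocity M a| ∧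
            0 ≤ ω * (ω - m * Kerr.horizonAngularVelocity M a)) →
            ∀ ρ : ℝ → ℝ, Kerr.IsTortoiseRadius M a ρ →
            ∀ uH uH₁ uI uI₁ : ℝ → ℂ,
              (∀ x, HasDerivAt uH (uH₁ x) x ∧
                HasDerivAt uH₁ (-(((ω ^ 2 - Kerr.sepPotential M a ω m Λ (ρ x) : ℝ) : ℂ) * uH x)) x) →
              (∀ x, HasDerivAt uI (uI₁ x) x ∧
                HasDerivAt uI₁ (-(((ω ^ 2 - Kerr.sepPotential M a ω m Λ (ρ x) : ℝ) : ℂ) * uI x)) x) →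
              Tendsto (fun x ↦ ‖uH x‖) atBot (𝓝 1) →
              Tendsto (fun x ↦ ‖uH₁ x‖) atBot (𝓝 |ω - m * Kerr.horizonAngularVelocity M a|) →
              (∀ x, (starRingEnd ℂ (uH x) * uH₁ x).im = -(ω - m * Kerr.horizonAngularVelocity M a)) →
              Tendsto (fun x ↦ ‖uI x‖) atTop (𝓝 1) →
              Tendsto (fun x ↦ ‖uI₁ x‖) atTop (𝓝 |ω|) →
              (∀ x, (starRingEnd ℂ (uI x) * uI₁ x).im = ω) →
                ∀ x x' : ℝ, x ≤ x' → Kerr.rPlus M a + θ * (Kerr.rPlus M a - Kerr.rMinus M a) ≤ ρ x' →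
                  ‖uH x‖ * ‖uI x'‖ ≤
                    C * Λ ^ N * (Kerr.surfaceGravity M a)⁻¹ ^ N * ‖uH x * uI₁ x - uI x * uH₁ x‖) := by
  intro hN δ hδ M hM θ _hθ
  obtain ⟨a₁, ε₀, ha₁, hε₀, hcen⟩ := hN M hM
  obtain ⟨cK, N, hcK, hK⟩ := Kerr.kernelConstant_le_pow
  have hMi : 0 < M⁻¹ := inv_pos.2 hM
  have hδi : 0 < δ⁻¹ := inv_pos.2 hδ
  have hA₀ : 0 < 8 * (1 + M + M⁻¹) ^ 4 * (1 + δ⁻¹) := by positivity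
  refine ⟨max a₁ (M / 2), min ε₀ (1 / (16 * M)), cK * (8 * (1 + M + M⁻¹) ^ 4 * (1 + δ⁻¹)) ^ N, N,
    max_lt ha₁ (by linarith), lt_min hε₀ (by positivity), by positivity, ?_⟩
  intro a ha hsub ω m Λ hadm hm hcone hreg ρ hρ uH uH₁ uI uI₁ hu hv hH0 hH1 hHf hI0 hI1 hIf x x' hxx' _
  obtain ⟨hflux, hsign⟩ := hreg
  have haM : |a| ≤ M := le_of_lt hsub
  have ha2 : M / 2 ≤ |a| := le_trans (le_max_right _ _) ha
  have ha1 : a₁ ≤ |a| := le_trans (le_max_left _ _) ha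
  have hε16 : min ε₀ (1 / (16 * M)) ≤ 1 / (16 * M) := min_le_right _ _
  have hκ : 0 < Kerr.surfaceGravity M a := hsub.surfaceGravity_pos
  have hκle : Kerr.surfaceGravity M a ≤ 1 / (4 * M) := Kerr.surfaceGravity_le hM a
  set κ := Kerr.surfaceGravity M a with hκdef
  set σ := ω - (m : ℝ) * Kerr.horizonAngularVelocity M a with hσ
  -- the census at this frequency
  have hord : (Ioi (Kerr.rPlus M a) ∩ {r : ℝ | ω ^ 2 ≤ Kerr.sepPotential M a ω m Λ r}).OrdConnected :=
    hcen a ha1 hsub ω m Λ hadm hm.ne'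
      (hcone.trans (mul_le_mul_of_nonneg_right (min_le_left _ _) (abs_nonneg _)))
  -- cone arithmetic
  obtain ⟨hω16, hωm, hσm⟩ := Kerr.cone_abs_omega_bounds hM haM ha2 hm hε16 hcone
  have hm1 : (1 : ℝ) ≤ m := by exact_mod_cast hm
  have hΛ1 : 1 ≤ Λ := by nlinarith [hadm.sq_le]
  have hω0 : ω ≠ 0 := by
    intro e; rw [e, abs_zero] at hω16
    have : 0 < 1 / (16 * M) := by positivity
    linarith
  have hσ0 : σ ≠ 0 := by
    intro e
    have h1 : |σ| = 0 := by rw [e, abs_zero]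
    have h2 : 0 < δ * κ := mul_pos hδ hκ
    rw [h1] at hflux; linarith
  have hωσ : 0 < ω * σ := lt_of_le_of_ne hsign (Ne.symm (mul_ne_zero hω0 hσ0))
  have hσΛ : σ ^ 2 * M ^ 2 ≤ Λ := sigma_sq_mul_sq_le hM hσm hadm.sq_le
  -- the auxiliary exponent `η`
  obtain ⟨hη0, hηκ, hησ, hηM⟩ := eta_bounds hδ hκ hM hκle hflux
  set η := min δ 1 * κ / 2 with hη
  -- the quantities entering the explicit constant
  set Φ := ω ^ 2 + 6 * Λ / M ^ 2 with hΦ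
  set R := max (7 * M) (max (Real.sqrt (12 * Λ) / |ω|) (1 / (M * ω ^ 2))) with hR
  set L := 25 / κ * Real.log (2496 * Λ / (σ ^ 2 * M ^ 2)) with hL
  set E := Real.exp (2 * η * L) with hE
  -- the atoms are powers of `Y`
  set Y := 8 * (1 + M + M⁻¹) ^ 4 * (1 + δ⁻¹) * Λ / κ with hY
  have hat : 1 ≤ Y ∧ |σ|⁻¹ ≤ Y ∧ σ ^ 2 ≤ Y ^ 2 ∧ |ω| ≤ Y ∧ |ω|⁻¹ ≤ Y ∧ η⁻¹ ≤ Y ∧ η ^ 2 ≤ Y ∧ Λ ≤ Y ∧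
      κ⁻¹ ≤ Y ∧ M ≤ Y ∧ M⁻¹ ≤ Y ∧ (M ^ 2)⁻¹ ≤ Y :=
    Kerr.coneMaster_bounds hsub ha2 hadm hm hε16 hcone hδ hflux
  obtain ⟨hY1, hσi, hσ2Y, hωY, hωi, hηi, hη2Y, hΛY, hκi, hMY, hMiY, hM2i⟩ := hat
  -- make the abbreviations opaque (keeps the arithmetic tactics away from the large bodies)
  clear_value Φ R L E Y η
  have hY0 : 0 < Y := by linarith only [hY1]
  have hω2Y : ω ^ 2 ≤ Y ^ 2 := by rw [← sq_abs]; exact pow_le_pow_left₀ (abs_nonneg _) hωY 2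
  have hΦ0 : 0 ≤ Φ := by rw [hΦ]; positivity
  have hΦ7 : Φ ≤ 7 * Y ^ 2 := by
    have h1 : 6 * Λ / M ^ 2 ≤ 6 * Y ^ 2 := by
      rw [div_eq_mul_inv]
      calc 6 * Λ * (M ^ 2)⁻¹ ≤ 6 * Y * Y :=
            mul_le_mul (by linarith only [hΛY]) hM2i (by positivity) (by positivity)
        _ = 6 * Y ^ 2 := by ring
    rw [hΦ]; linarith only [h1, hω2Y]
  have hR0 : 0 ≤ R := by rw [hR]; exact le_trans (by positivity) (le_max_left _ _)
  have hR12 : R ≤ 12 * Y ^ 3 := by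
    rw [hR]; exact Kerr.farRadius_le_pow hY1 hΛ1 hΛY hMY hMiY (abs_pos.2 hω0) hωi
  have hQ : 1 ≤ 2496 * Λ / (σ ^ 2 * M ^ 2) := by
    rw [le_div_iff₀ (by positivity), one_mul]
    calc σ ^ 2 * M ^ 2 ≤ Λ := hσΛ
      _ ≤ 2496 * Λ := by linarith only [hΛ1]
  have hQ4 : 2496 * Λ / (σ ^ 2 * M ^ 2) ≤ 2496 * Y ^ 4 := Kerr.logArg_le_pow hY1 hΛY hσ0 hσi hM hM2i
  have hlog0 : 0 ≤ Real.log (2496 * Λ / (σ ^ 2 * M ^ 2)) := Real.log_nonneg hQ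
  have hL0 : 0 ≤ L := by rw [hL]; exact mul_nonneg (div_nonneg (by norm_num) hκ.le) hlog0
  have hL5 : L ≤ 62400 * Y ^ 5 := by
    have h1 : Real.log (2496 * Λ / (σ ^ 2 * M ^ 2)) ≤ 2496 * Y ^ 4 := by
      have := Real.log_le_sub_one_of_pos (lt_of_lt_of_le one_pos hQ)
      linarith only [this, hQ4]
    have h2 : 25 / κ ≤ 25 * Y := by
      rw [div_eq_mul_inv]; exact mul_le_mul_of_nonneg_left hκi (by norm_num)
    calc L = 25 / κ * Real.log (2496 * Λ / (σ ^ 2 * M ^ 2)) := hL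
      _ ≤ (25 * Y) * (2496 * Y ^ 4) := mul_le_mul h2 h1 hlog0 (by positivity)
      _ = 62400 * Y ^ 5 := by ring
  have hE0 : 0 ≤ E := by rw [hE]; positivity
  have hE100 : E ≤ 2496 ^ 25 * Y ^ 100 := by
    have h1 : E ≤ (2496 * Λ / (σ ^ 2 * M ^ 2)) ^ 25 := by
      rw [hE, hL]; exact Kerr.exp_le_logArg_pow hκ hηκ hQ
    have h2 : (2496 * Λ / (σ ^ 2 * M ^ 2)) ^ 25 ≤ (2496 * Y ^ 4) ^ 25 :=
      pow_le_pow_left₀ (by positivity) hQ4 25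
    calc E ≤ (2496 * Y ^ 4) ^ 25 := h1.trans h2
      _ = 2496 ^ 25 * Y ^ 100 := by ring
  have hW0 : 0 ≤ ‖uH x * uI₁ x - uI x * uH₁ x‖ := norm_nonneg _
  have hYN : Y ^ N = (8 * (1 + M + M⁻¹) ^ 4 * (1 + δ⁻¹)) ^ N * Λ ^ N * κ⁻¹ ^ N := by
    rw [hY, div_eq_mul_inv, mul_pow, mul_pow]
  -- the kernel bound with its explicit constant, and the bound of that constant (huge terms: no
  -- `linarith` beyond this point)
  have key := Kerr.fluxRegime_kernel_le hρ hsub hadm hΛ1 hωσ hσΛ hord hu hv hH0 hH1 hHf hI0 hI1 hIf hη0 hησ hηM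
    hσ hΦ hR hL hE hxx'
  have hKle := hK Y σ ω η Φ R L E hY1 hη0 hωσ hσi hσ2Y hωY hωi hηi hη2Y hΦ0 hΦ7 hR0 hR12 hL0 hL5 hE0
    hE100
  -- combine
  calc ‖uH x‖ * ‖uI x'‖ ≤ _ := key
    _ ≤ cK * Y ^ N * ‖uH x * uI₁ x - uI x * uH₁ x‖ := mul_le_mul_of_nonneg_right hKle hW0
    _ = cK * (8 * (1 + M + M⁻¹) ^ 4 * (1 + δ⁻¹)) ^ N * Λ ^ N * κ⁻¹ ^ N *
          ‖uH x * uI₁ x - uI x * uH₁ x‖ := by rw [hYN]; ring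

end Summit.FinalStateConjecture.FinalStateConjecture.Theorems.KappaExplicitWaveDecay.OlverDunsterUniformReduction

end
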